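import Summits.BirchSwinnertonDyer.Rank1Residual.X12.O11.RamifiedStrictDescentAtThreeRegimeV
import Summits.BirchSwinnertonDyer.Rank1Residual.X11b.AnticyclotomicControlNPlus
import HarnessLib

/-!
# O11 at `p = 3`, companion VI-b — regime V of route `PrintCFram` (item stmt-BirchSwinnertonDyer-20700):
# (R-ctrl)₃ᵛ♯ holds OUTRIGHT, (R-tors)₃ᵛ follows from GZK, and `BSD(W, 3)` on regimes N ∪ V follows
# from the ONE residual (R-EU)₃ᵛ + four named facts — with `T₀ = Σ(N⁺)`, NO away binder at all
# (cell `bsd-print-cfram`, D-0131 (2), typer `ty2` gen 2; PLAN v3 §2 ty2 (γ′); sequel of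
# `RamifiedStrictDescentAtThreeRegimeV.lean`, split for the ≤ 400-line rule)

HONEST FRAMING (cell `bsd-print-cfram`, HOME `run/shared/lean/pub/bsd-print-cfram/`): THEOREMS ONLY
(no definition, no named fact, no axiom, no `sorry`); nothing about BSD is booked; regime V and the
leaf stay OPEN; beyond-print theorem: NO.

* §4 `ramifiedCMDefectControlAtThree_holds` — (R-ctrl)₃ᵛ♯ is a THEOREM for every elliptic `W/ℚ`:
  companion V's exact count `#Sel^γ = #Sel_str(W)·#Sel_str(W')·d(T₀)`
  (`natCard_invariants_eq_strictSelmer_mul_defect_of_isFrameThree`) + Greenberg's Lemma 4.2 Euler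
  characteristic (k7r-c4 `eulerIdentity_of_hasCharValuationAt`); finiteness of `Sel_𝔭(K)` from that of
  `Sel^γ` by injectivity of the control map under (A𝔭)₃. `ramifiedCMStrictTorsionAtThreeV_of_GZK` —
  (R-tors)₃ᵛ ⟸ GZK (companion V's finiteness transfer replaces gen 1's exact control).
  `bsdp_three_of_ramifiedCMEllipticUnitIndexAtThreeV` — the consumer with both discharged.
* §5 `nPlus_admissible_three` — `T₀ = Σ(N⁺)` at `3` (`X11b.nPlusPlaces W K 3`: degree-one places
  `v ∤ 3` over `ℓ ∣ N_W`) is admissible at EVERY frame (off it a degree-one `v ∤ 3` is good); hence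
  `bsdp_three_of_indexLawAtThreeV_of_isFrameThree`: `BSDp W 3` at ANY analytic-rank-one `3`-frame with
  (A𝔭)₃ from (R-EU)₃ᵛ alone + four facts — regimes N ∪ V of the route TOGETHER, no away binder.

References: [GreenbergLNM1716] §3 Lemmas 3.1–3.3, p. 90, §4 Lemma 4.2 (p. 102), Prop. 4.13;
[Kolyvagin1990] Thm. A; [Castella2018] Def. 2.2, Thm. 2.3 (shape); [Miller2011LMS] Def. 1.1;
[Cassels1965ArithmeticVIII]; [GrossZagier1986] Thm. I.(7.3); [SilvermanAEC2009] VII.5 Prop. 5.1(a);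
tree: companions I–VI, X11b `AnticyclotomicControlNPlus`; HOME/DOSSIER.md §32, §35; PLAN v3 §2 ty2.
-/

noncomputable section

open scoped Classical

open WeierstrassCurve NumberField IsDedekindDomain Field PowerSeries
  Literature.NumberTheory.EllipticCurves
  Literature.NumberTheory.EllipticCurves.GreenbergSelmer
  Literature.NumberTheory.EllipticCurves.Rank1Residual
  Literature.NumberTheory.GaloisRepresentations
  Summit.BirchSwinnertonDyer.Rank1Residual
  Summit.BirchSwinnertonDyer.Rank1Residual.Additive
  Summit.BirchSwinnertonDyer.Rank1Residual.X11b
  Summit.BirchSwinnertonDyer.Rank1Residual.X11b.AcSelmer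
  Summit.BirchSwinnertonDyer.BirchSwinnertonDyer.Theorems

namespace Summit.BirchSwinnertonDyer.Rank1Residual.X12.O11

variable (W : WeierstrassCurve ℚ) [W.IsElliptic] [W.IsGloballyMinimal]

/-! ## §4 (R-ctrl)₃ᵛ♯ holds outright; (R-tors)₃ᵛ from GZK; the consumer from (R-EU)₃ᵛ alone -/

section Discharge

omit [W.IsGloballyMinimal] in
/-- **(R-ctrl)₃ᵛ♯ is a THEOREM: `RamifiedCMDefectControlAtThree W` for every elliptic `W/ℚ`.**
From `ord₃ f(0) = n₀`: `Sel^γ` is finite and `n₀ + log₃ #X[T] = log₃ #Sel^γ` (Greenberg's Lemma 4.2,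
k7r-c4's `eulerIdentity_of_hasCharValuationAt`); the control map is injective under (A𝔭)₃
(`controlMap_injective_of_fixedPoints_eq_bot`), so `Sel_𝔭(K, W[3^∞])` is finite too; companion V's
exact count `#Sel^γ = #Sel_str(W)·#Sel_str(W')·d(T₀)` (`natCard_invariants_eq_strictSelmer_mul_defect_of_isFrameThree`);
`log₃` of a non-zero product is additive. No class hypothesis, no named fact.
[cite: GreenbergLNM1716, §3 Lemmas 3.1–3.3, p. 90 and §4 Lemma 4.2 (p. 102)] -/
theorem ramifiedCMDefectControlAtThree_holds : RamifiedCMDefectControlAtThree W := by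
  intro K _ _ 𝔭 W' _ _ C hF _ κ hκ γ hγ P n P' n' _ _ htors _ _ _ _ htors' _ _ T₀ hT₀ hv n₀ hchar _
  haveI : (W.baseChange K).IsElliptic := by rw [baseChange]; infer_instance
  have h𝔭 := noThreeTorsion_adicCompletion_of_isFrameThree W hF htors htors'
  -- Euler characteristic: `Sel^γ` finite and `n₀ + log₃ #X[T] = log₃ #Sel^γ`
  obtain ⟨hfinγ, -, heuler⟩ :=
    RamifiedSevenEllipticUnits.eulerIdentity_of_hasCharValuationAt (W.baseChange K) 3 κ 𝔭 γ hchar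
  -- `Sel_𝔭(K, W[3^∞])` is finite: the control map is injective under (A𝔭)₃
  haveI hfinγ' : Finite (IwasawaDual.endInvariants (conjSelmerAc (W.baseChange K) 3 κ 𝔭 ∅ γ - 1)) :=
    hfinγ
  have hinj : Function.Injective (controlMap (W.baseChange K) 3 κ 𝔭 ∅ γ) :=
    controlMap_injective_of_fixedPoints_eq_bot hγ.out
      (RamifiedSevenEllipticUnits.fixedPoints_kerSubgroup_eq_bot_of_noPTorsion
        (W.baseChange K) 3 κ 𝔭 h𝔭) γ
  haveI : Finite (selmerAcBase (W.baseChange K) 3 𝔭 ∅) := Finite.of_injective _ hinj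
  -- the exact count of companion V
  obtain ⟨hcount, -⟩ := natCard_invariants_eq_strictSelmer_mul_defect_of_isFrameThree hF κ hκ γ htors
    htors' T₀ hT₀ hv
  rw [← controlDefectAtThree_def] at hcount
  -- all factors are non-zero (finite non-empty groups)
  have hne : Nat.card ↥(strictSelmerPInfty W 3) * Nat.card ↥(strictSelmerPInfty W' 3) *
      controlDefectAtThree W K 𝔭 κ T₀ ≠ 0 := by
    rw [← hcount]
    exact Nat.card_pos.ne'
  have hne12 : Nat.card ↥(strictSelmerPInfty W 3) * Nat.card ↥(strictSelmerPInfty W' 3) ≠ 0 :=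
    left_ne_zero_of_mul hne
  have hB : padicValNat 3 (Nat.card (IwasawaDual.endInvariants
      (Castella2018.AcSelmer.conjSelmerAc (W.baseChange K) 3 κ 𝔭 ∅ γ - 1))) =
      padicValNat 3 (Nat.card ↥(strictSelmerPInfty W 3)) +
        padicValNat 3 (Nat.card ↥(strictSelmerPInfty W' 3)) +
        padicValNat 3 (controlDefectAtThree W K 𝔭 κ T₀) := by
    rw [hcount, padicValNat.mul hne12 (right_ne_zero_of_mul hne),
      padicValNat.mul (left_ne_zero_of_mul hne12) (right_ne_zero_of_mul hne12)]
  have key : ((n₀ : ℤ) + padicValNat 3 (Nat.card {x : Castella2018.AcSelmer.XAc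
      (W.baseChange K) 3 κ 𝔭 ∅ γ // (PowerSeries.X : IwasawaAlgebra 3) • x = 0})) =
      (padicValNat 3 (Nat.card ↥(strictSelmerPInfty W 3)) : ℤ) +
        padicValNat 3 (Nat.card ↥(strictSelmerPInfty W' 3)) +
        padicValNat 3 (controlDefectAtThree W K 𝔭 κ T₀) := by
    have h := heuler
    rw [hB] at h
    exact_mod_cast h
  exact key

omit [W.IsGloballyMinimal] in
/-- **(R-tors)₃ᵛ from Gross–Zagier–Kolyvagin alone** (`hGZK`): at an analytic-rank-one `3`-frame both
`ℚ`-side strict `3^∞`-Selmer groups are finite under GZK (`W' ∼ W`), hence `Sel_𝔭(K, W[3^∞])` by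
(D♮)₃, hence `Sel^γ` by companion V's finiteness transfer (injective res under (A𝔭)₃ — NO away input
at `T₀`), and Greenberg's criterion + Lemma 4.2 give the shape. Gen 1's `ramifiedCMStrictTorsionAtThree_of_GZK`
with exact control replaced by the defect identity. [cite: Kolyvagin1990, Thm. A]
[cite: GreenbergLNM1716, §1 p. 61, §3 Thm. 1.2 and §4 Lemma 4.2] -/
theorem ramifiedCMStrictTorsionAtThreeV_of_GZK (hGZK : rank_eq_analyticRank_of_analyticRank_le_one) :
    RamifiedCMStrictTorsionAtThreeV W := by
  intro K _ _ 𝔭 W' _ _ C hF hr κ hκ γ _ htors htors' T₀ hT₀ hv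
  haveI : (W.baseChange K).IsElliptic := by rw [baseChange]; infer_instance
  have h𝔭 := noThreeTorsion_adicCompletion_of_isFrameThree W hF htors htors'
  have hr' : W'.analyticRank = 1 := by
    rw [← analyticRank_eq_of_isIsogenous' (isIsogenous_of_isFrameThree hF), hr]
  have hfinW : Finite ↥(strictSelmerPInfty W 3) :=
    RamifiedSevenEllipticUnits.finite_strictSelmerPInfty_of_GZK hGZK W 3 hr
  have hfinW' : Finite ↥(strictSelmerPInfty W' 3) :=
    RamifiedSevenEllipticUnits.finite_strictSelmerPInfty_of_GZK hGZK W' 3 hr'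
  haveI hbase : Finite (selmerAcBase (W.baseChange K) 3 𝔭 ∅) := by
    refine Nat.finite_of_card_ne_zero ?_
    rw [natCard_selmerAcBase_frameThree_eq_mul W hF]
    exact mul_ne_zero Nat.card_pos.ne' Nat.card_pos.ne'
  have hfin := (natCard_invariants_eq_mul_defect_of_isFrameThree hF κ hκ γ h𝔭 T₀ hT₀ hv).1
  obtain ⟨n₀, hn₀, hfinT⟩ :=
    RamifiedSevenEllipticUnits.exists_hasCharValuationAt_and_finite_of_finite
      (W.baseChange K) 3 κ 𝔭 γ hfin
  exact ⟨⟨n₀, hn₀⟩, hfinT⟩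

variable {W}
variable {K : Type} [Field K] [NumberField K] {𝔭 : HeightOneSpectrum (𝓞 K)}
  {W' : WeierstrassCurve ℚ} [W'.IsElliptic] [W'.IsGloballyMinimal] {C : VariableChange ℚ}
  {κ : ZpExtension K 3} {P : W.toAffine.Point} {n : ℕ} {P' : W'.toAffine.Point} {n' : ℕ}

/-- **`BSD(W, 3)` on regimes N ∪ V from (R-EU)₃ᵛ alone + four named facts**: `bsdp_three_of_halvesV`
with (R-tors)₃ᵛ ⟸ GZK and (R-ctrl)₃ᵛ♯ a theorem. Displayed: frame, `r_an(W) = 1`, anticyclotomic `κ`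
with generator, generators with levels, (A𝔭)₃, a finite `T₀` of places `v ∤ 3` with (Av)₃ off `T₀`,
and modularity / Gross–Zagier I.(7.3) / GZK / Cassels. So on regime V the corner's ONE residual input is
(R-EU)₃ᵛ — CONSTRUCTION / OPEN; nothing is asserted about it.
[cite: Miller2011LMS, §1 and Def. 1.1] [cite: Cassels1965ArithmeticVIII] [cite: GrossZagier1986, Thm. I.(7.3)] -/
theorem bsdp_three_of_ramifiedCMEllipticUnitIndexAtThreeV (hmod : hasEntireLFunction_rat)
    (hGZ : GrossZagier1986_thm_I_7_3) (hGZK : rank_eq_analyticRank_of_analyticRank_le_one)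
    (hCassels : bsdRHS_eq_of_isIsogenous) (h3 : RamifiedCMEllipticUnitIndexAtThreeV W)
    (hF : IsFrameThree W K 𝔭 W' C) (hr : W.analyticRank = 1)
    (hκ : κ.IsAnticyclotomic) (γ : absoluteGaloisGroup K) [Fact (κ.IsTopGenerator γ)]
    (hP : ¬ IsOfFinAddOrder P)
    (hgen : ∀ R : W.toAffine.Point, ∃ (k : ℤ) (T : W.toAffine.Point),
      IsOfFinAddOrder T ∧ R = k • P + T)
    (htors : ∀ Q : (W.baseChange ℚ_[3]).toAffine.Point, (3 : ℕ) • Q = 0 → Q = 0)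
    (hdiv : ∃ Q : (W.baseChange ℚ_[3]).toAffine.Point, (3 : ℕ) ^ n • Q = W.toPadicPoint 3 P)
    (hndiv : ∀ Q : (W.baseChange ℚ_[3]).toAffine.Point, (3 : ℕ) ^ (n + 1) • Q ≠ W.toPadicPoint 3 P)
    (hP' : ¬ IsOfFinAddOrder P')
    (hgen' : ∀ R : W'.toAffine.Point, ∃ (k : ℤ) (T : W'.toAffine.Point),
      IsOfFinAddOrder T ∧ R = k • P' + T)
    (htors' : ∀ Q : (W'.baseChange ℚ_[3]).toAffine.Point, (3 : ℕ) • Q = 0 → Q = 0)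
    (hdiv' : ∃ Q : (W'.baseChange ℚ_[3]).toAffine.Point, (3 : ℕ) ^ n' • Q = W'.toPadicPoint 3 P')
    (hndiv' : ∀ Q : (W'.baseChange ℚ_[3]).toAffine.Point,
      (3 : ℕ) ^ (n' + 1) • Q ≠ W'.toPadicPoint 3 P')
    (T₀ : Finset (HeightOneSpectrum (𝓞 K))) (hT₀ : ∀ v ∈ T₀, ((3 : ℕ) : 𝓞 K) ∉ v.asIdeal)
    (hv : ∀ v : HeightOneSpectrum (𝓞 K), v ∉ T₀ → ((3 : ℕ) : 𝓞 K) ∉ v.asIdeal →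
      v.asIdeal.ramificationIdx (𝓞 ℚ) = 1 → v.asIdeal.inertiaDeg (𝓞 ℚ) = 1 →
      (W.baseChange K).HasGoodReductionAt v ∨
        ∀ R : ((W.baseChange K).baseChange (v.adicCompletion K)).toAffine.Point,
          (3 : ℕ) • R = 0 → R = 0) :
    BSDp W 3 :=
  bsdp_three_of_halvesV hmod hGZ hGZK hCassels (ramifiedCMStrictTorsionAtThreeV_of_GZK W hGZK)
    (ramifiedCMDefectControlAtThree_holds W) h3 hF hr hκ γ hP hgen htors hdiv hndiv hP' hgen' htors'
    hdiv' hndiv' T₀ hT₀ hv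

end Discharge

/-! ## §5 `T₀ = Σ(N⁺)` is admissible at every frame: the consumer with NO away binder -/

section NPlus

variable {W}
variable {K : Type} [Field K] [NumberField K]

omit [W.IsGloballyMinimal] in
/-- **Off `Σ(N⁺)` every degree-one `v ∤ 3` is a place of good reduction** (`Σ(N⁺) = X11b.nPlusPlaces W K 3`
= the places `v ∤ 3` of degree one over the primes `ℓ ∣ N_W`): so (Av)₃ holds off `T₀ = Σ(N⁺)` with
the left disjunct, at every `W` and `K`. [cite: SilvermanAEC2009, VII.5 Prop. 5.1(a)]
[cite: Castella2018, §2.1 (arXiv:1704.06608 p. 5) (the finite set `Σ`)] -/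
theorem nPlus_admissible_three (hK : Module.finrank ℚ K = 2) :
    (∀ v ∈ (nPlusPlaces_finite (W := W) (K := K) (p := 3) hK).toFinset,
        ((3 : ℕ) : 𝓞 K) ∉ v.asIdeal) ∧
      ∀ v : HeightOneSpectrum (𝓞 K), v ∉ (nPlusPlaces_finite (W := W) (K := K) (p := 3) hK).toFinset →
        ((3 : ℕ) : 𝓞 K) ∉ v.asIdeal →
        v.asIdeal.ramificationIdx (𝓞 ℚ) = 1 → v.asIdeal.inertiaDeg (𝓞 ℚ) = 1 →
        (W.baseChange K).HasGoodReductionAt v ∨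
          ∀ R : ((W.baseChange K).baseChange (v.adicCompletion K)).toAffine.Point,
            (3 : ℕ) • R = 0 → R = 0 := by
  refine ⟨fun v hv => ((Set.Finite.mem_toFinset _).mp hv).1, fun v hvT hpv he hf => Or.inl ?_⟩
  by_contra hbad
  exact hvT ((Set.Finite.mem_toFinset _).mpr (mem_nPlusPlaces_of v hpv
    (primesEquiv_under_dvd_conductorNorm_of_not_hasGoodReductionAt K v hbad) he hf))

variable {𝔭 : HeightOneSpectrum (𝓞 K)} {W' : WeierstrassCurve ℚ} [W'.IsElliptic] [W'.IsGloballyMinimal]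
  {C : VariableChange ℚ}

/-- **`BSD(W, 3)` at ANY analytic-rank-one `3`-frame with (A𝔭)₃ — regimes N ∪ V together, NO away
binder — from (R-EU)₃ᵛ alone + four named facts.** Take `T₀ = Σ(N⁺)` (§5 admissible) and build the
frame data for the GIVEN frame (anticyclotomic `ℤ₃`-tower of `K` with generator; Mordell–Weil
generators of `W`, `W'` with their `3`-divisibility levels, rank one by GZK / isogeny invariance), then
§4. So on the union of the route's regimes N and V, curve by curve, `BSD(W, 3)` follows from the ONE
typed input (R-EU)₃ᵛ (modulo the four facts); the V item `SplitPlaceTorsionBSDThree` is the special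
case where (Av)₃ fails somewhere. CONDITIONAL on (R-EU)₃ᵛ; nothing booked.
[cite: Miller2011LMS, §1 and Def. 1.1] [cite: Darmon2004, Thm. 3.22 and §3.9] [cite: Washington1997, Thm. 13.4] -/
theorem bsdp_three_of_indexLawAtThreeV_of_isFrameThree (hmod : hasEntireLFunction_rat)
    (hGZ : GrossZagier1986_thm_I_7_3) (hGZK : rank_eq_analyticRank_of_analyticRank_le_one)
    (hCassels : bsdRHS_eq_of_isIsogenous) (hF : IsFrameThree W K 𝔭 W' C) (hr : W.analyticRank = 1)
    (htors : ∀ Q : (W.baseChange ℚ_[3]).toAffine.Point, (3 : ℕ) • Q = 0 → Q = 0)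
    (htors' : ∀ Q : (W'.baseChange ℚ_[3]).toAffine.Point, (3 : ℕ) • Q = 0 → Q = 0)
    (h3 : RamifiedCMEllipticUnitIndexAtThreeV W) : BSDp W 3 := by
  have hK : IsImaginaryQuadratic K := hF.2.2.1
  have hiso : IsIsogenous W W' := isIsogenous_of_isFrameThree hF
  obtain ⟨κ, hκ⟩ := ZpExtension.exists_isAnticyclotomic_holds (K := K) (p := 3) hK.1
    (fun w => hK.2.isComplex w)
  obtain ⟨γ, hγ⟩ := κ.exists_isTopGenerator
  haveI : Fact (κ.IsTopGenerator γ) := ⟨hγ⟩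
  have hrank : W.mordellWeilRank = 1 := by rw [(hGZK W hr.le).1, hr]
  have hr' : W'.analyticRank = 1 := by rw [← analyticRank_eq_of_isIsogenous' hiso, hr]
  have hrank' : W'.mordellWeilRank = 1 := by rw [(hGZK W' hr'.le).1, hr']
  obtain ⟨P, n, hP, hgen, hdiv, hndiv⟩ :=
    RamifiedSevenEllipticUnits.exists_generator_with_level W 3 hrank
  obtain ⟨P', n', hP', hgen', hdiv', hndiv'⟩ :=
    RamifiedSevenEllipticUnits.exists_generator_with_level W' 3 hrank'
  obtain ⟨hT₀, hv⟩ := nPlus_admissible_three (W := W) (K := K) hK.1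
  exact bsdp_three_of_ramifiedCMEllipticUnitIndexAtThreeV hmod hGZ hGZK hCassels h3 hF hr hκ γ hP
    hgen htors hdiv hndiv hP' hgen' htors' hdiv' hndiv' _ hT₀ hv

end NPlus

end Summit.BirchSwinnertonDyer.Rank1Residual.X12.O11

end
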